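/-
Copyright (c) 2026. All rights reserved.
Released under Apache 2.0 license as described in the file LICENSE.
Authors: abc-iut cell, seat abc-iut-L4-t6 (gen 9; row «P13viii′-NODAL-IV», step CT0-EXOTIC, part 2/2).
-/
import Literature.AnabelianGeometry.AbsoluteAnabelian.AbsTopII.DehnTwistFoxSplitExtension
import HarnessLib

/-!
# The fixed subgroup of a SINGLE non-trivial Dehn twist `shear κ` of `F̂₂` (`κ ∈ Ẑ ∖ {0}` arbitrary) is `Π_v`

S. Mochizuki, *Topics in Absolute Anabelian Geometry II* [AbsTopII] (`MochizukiAbsTopII2013`; kurims manuscript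
`paper:url-585b8d0ad0d9`), §1, Prop 1.3 (v) p. 12 ("`D_v = C_{Π_H}(I_v) = N_{Π_H}(I_v)`") and (viii) p. 12 (the
«Moreover» clause "`I_v = D_e ∩ D_{e'} ∩ Π_I`").  At the nodal Dehn-twist datum `DehnTwist.dpsc i hi` (abc-iut-L4-t6
`DehnTwistLoopDatum`: `Π_𝔾 = F̂₂ = ⟨a,b⟩^`, `Π_v = ⟨b^Ẑ, a b^Ẑ a⁻¹⟩^`, `Π_I = F̂₂ ⋊_{shear^i} Ẑ`, `I_v = 1 ⋊ Ẑ`),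
abc-iut-f-069 (gen 5, `DehnTwistFixedSubgroup`, p479118) proved HFix: an element fixed by `shear^i(κ^n)` for EVERY
`κ ∈ Ẑ` lies in `Π_v`.  The `I_v`-clause of the typed Prop 1.3 (viii′) (GAP row G-L4t6g8-2) meets twists by ONE
arbitrary `κ ∈ Ẑ ∖ {0}` — a zero divisor of `Ẑ = ∏_p ℤ_p`, or an element like `(p)_p` none of whose `Ẑ`-multiples is a
positive integer — to which HFix does not apply («exotic twist stabilisers», the obstruction named in the GAP row).

PROOF-ONLY file (no definition), abc-iut-L4-t6 (gen 9); part 2 of 2 — the engine (split-extension Fox calculus, the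
involution `θ`, steps (A)/(B) `foxA_pow_eq_one`/`foxB_pow_eq_one`) is part 1, `DehnTwistFoxSplitExtension.lean`.
MAIN THEOREM `mem_vertGp_of_shear_eq`:
**for every `κ : Ẑ` with `κ ≠ 1` (multiplicative notation for `κ ≠ 0`) and every `x ∈ F̂₂`, `shear κ x = x ⇒ x ∈ Π_v`.**
Hence `Fix(shear^i κ) = Π_v` for every single `κ ≠ 1` (`shearPow_eq_self_iff_mem_vertGp`), and in `Π_I` an element of
`Π_𝔾` commuting with ANY non-trivial element `(1, κ)` of the vertical inertia `I_v` lies in `Π_v × 1`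
(`mem_vertGp_of_commute_inr`, `centralizer_inf_PiG_eq_vertSub_of_mem_Iv`) — no exotic twist stabilisers.

ROUTE (Fox calculus in split extensions by PERMUTATION modules, finite quotient by finite quotient; classical:
Lyndon–Schupp Ch. II §3 [cite: LyndonSchupp2001, Ch. II §3]; complementary to abc-iut-f-069's coset-sum test
`FoxChain.mem_of_fox_chain`, which needs the twist exponent to be a unit of the coefficient field).  Fix a finite
quotient `ψ : F̂₂ → G`, `α = ψa`, `β = ψb`, a subgroup `Q ∋ β, αβα⁻¹`, a level `d` with `κ mod d ≠ 0`, and put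
`q := d · ord β`, `V := (G/Q → ℤ/q)` (written multiplicatively), `S := V ⋊ G` (`G` permuting cosets).  By the universal
property of `F̂₂` there are continuous `E_A, E_B, E₀ : F̂₂ → S` with prescribed generator values; the twist `κ^{ord β}`
fixes `x`, is TRIVIAL on `G`, and `E₀ ∘ shear(κ^{ord β})` differs from `E₀` (`a ↦ (1,α)`, `b ↦ (δ_Q, β)`) exactly by
`a ↦ (δ_{αQ}^M, α)` with `M = ord β · (κ mod e)` (`e` an exponent of `S` divisible by `q`) — so the "Fox derivative"
`(E_A x).left` (`E_A : a ↦ (δ_{αQ}, α)`, `b ↦ (1,β)`) satisfies `(E_A x).left^M = 1`; the involution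
`θ : a ↦ a⁻¹, b ↦ aba⁻¹` (`shear k ∘ θ = θ ∘ shear k⁻¹`) gives the same for `E_B : a ↦ (δ_Q⁻¹, α)`; the fundamental
formula `inl δ_Q⁻¹ · inr(ψx) · inl δ_Q = (δ_Q⁻¹ δ_{ψx Q}, ψx)` = `E_B ⊙ E_A` then yields `(δ_Q⁻¹ δ_{ψxQ})^M = 1`, and
`q ∤ M` (as `κ mod d ≠ 0`) forces `ψx ∈ Q`; finally `⋂_U Π_v U = Π_v`.
HONEST FRAMING: classical profinite group theory (free profinite groups, finite quotients) under OUR kernel check, at a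
constructed model (constructed ≠ geometric); consistency evidence for typed rows, not a discharge at geometric data;
nothing here bears on [IUTchIII] Cor 3.12; no side taken.
-/

noncomputable section

open scoped Pointwise

namespace Literature.AnabelianGeometry.AbsoluteAnabelian.AbsTopII.DehnTwist

open Literature.AnabelianGeometry.EtaleTheta.SettingModel
open Literature.AnabelianGeometry.EtaleTheta
open Literature.AnabelianGeometry.SemiGraphs.SemiGraphOfAnabelioids.IsProSigmaCompletion (zhat_monoidHom_apply_eq_pow)
open Function _root_.Topology

/-! ### §5 The main theorem: one finite quotient, then compactness -/

/-- **The image of a `shear κ`-fixed element (`κ ≠ 1`) in any finite quotient lies in the image of `Π_v`** — precisely, in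
any subgroup `Q` of the finite target containing the images of `b` and `aba⁻¹`. [cite: MochizukiAbsTopII2013, Prop 1.3 (v) p.12] -/
theorem map_mem_of_shear_eq {G : Type} [Group G] [Finite G] [TopologicalSpace G] [DiscreteTopology G]
    (ψ : F₂hatT →ₜ* G) (Q : Subgroup G) (hβ : ψ genB ∈ Q) (hαβ : ψ genA * ψ genB * (ψ genA)⁻¹ ∈ Q)
    {κ : ZH} (hκ : κ ≠ 1) {x : F₂hatT} (hx : shear κ x = x) : ψ x ∈ Q := by
  classical
  -- a level `d` at which `κ` is visible
  obtain ⟨d, hd⟩ : ∃ d : ℕ+, ZHatLevel.level d κ ≠ 1 := by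
    by_contra h
    refine hκ (ZHatLevel.ext_of_level fun n => ?_)
    rw [map_one]
    by_contra h'
    exact h ⟨n, h'⟩
  set α := ψ genA with hα
  set β := ψ genB with hβdef
  set m : ℕ := orderOf β with hm
  have hm0 : 0 < m := orderOf_pos β
  have hβm : β ^ m = 1 := pow_orderOf_eq_one β
  -- the modulus `q = d · m` and the finite split extension `S = (G/Q → ℤ/q) ⋊ G`
  set q : ℕ := d * m with hq
  haveI : NeZero q := ⟨Nat.pos_iff_ne_zero.mp (Nat.mul_pos d.pos hm0)⟩
  letI : TopologicalSpace ((G ⧸ Q → Multiplicative (ZMod q)) ⋊[mulAutArrow] G) := ⊥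
  haveI : DiscreteTopology ((G ⧸ Q → Multiplicative (ZMod q)) ⋊[mulAutArrow] G) := ⟨rfl⟩
  haveI : Finite ((G ⧸ Q → Multiplicative (ZMod q)) ⋊[mulAutArrow] G) :=
    Finite.of_equiv _ (SemidirectProduct.equivProd).symm
  -- an exponent `e` of `S` divisible by `d`
  set c : ℕ := Nat.card ((G ⧸ Q → Multiplicative (ZMod q)) ⋊[mulAutArrow] G) with hc
  have hc0 : 0 < c := Nat.card_pos
  set m' : ℕ+ := ⟨m * c, Nat.mul_pos hm0 hc0⟩ with hm'
  have he : ∀ s : (G ⧸ Q → Multiplicative (ZMod q)) ⋊[mulAutArrow] G, s ^ ((d * m' : ℕ+) : ℕ) = 1 := by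
    intro s
    show s ^ ((d : ℕ) * (m * c)) = 1
    rw [← mul_assoc, mul_comm, pow_mul, pow_card_eq_one', one_pow]
  set n : ℕ := (Multiplicative.toAdd (ZHatLevel.level (d * m') κ)).val with hn
  -- the two Fox homomorphisms
  set d1 : G ⧸ Q → Multiplicative (ZMod q) := Pi.mulSingle ((1 : G) : G ⧸ Q) (Multiplicative.ofAdd 1) with hd1
  set dα : G ⧸ Q → Multiplicative (ZMod q) := Pi.mulSingle ((α : G) : G ⧸ Q) (Multiplicative.ofAdd 1) with hdα
  obtain ⟨EA, hAa, hAb⟩ := exists_ext_semidirect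
    (⟨dα, α⟩ : (G ⧸ Q → Multiplicative (ZMod q)) ⋊[mulAutArrow] G) (SemidirectProduct.inr β)
  obtain ⟨EB, hBa, hBb⟩ := exists_ext_semidirect
    (⟨d1⁻¹, α⟩ : (G ⧸ Q → Multiplicative (ZMod q)) ⋊[mulAutArrow] G) (SemidirectProduct.inr β)
  have hA := foxA_pow_eq_one Q q α β hβ hβm hx (d * m') he EA hAa hAb
  have hB := foxB_pow_eq_one Q q α β hαβ hβm hx (d * m') he EB hBa hBb
  -- the fundamental formula: `Λ y = inl δ_Q⁻¹ · inr (ψ y) · inl δ_Q = E_B ⊙ E_A`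
  let Λ : F₂hatT →ₜ* (G ⧸ Q → Multiplicative (ZMod q)) ⋊[mulAutArrow] G :=
    { toMonoidHom := ((MulAut.conj (SemidirectProduct.inl d1)⁻¹).toMonoidHom.comp
        (SemidirectProduct.inr : G →* (G ⧸ Q → Multiplicative (ZMod q)) ⋊[mulAutArrow] G)).comp ψ.toMonoidHom
      continuous_toFun := by
        exact (continuous_of_discreteTopology (f := fun g : G =>
          (MulAut.conj (SemidirectProduct.inl d1)⁻¹ :
            MulAut ((G ⧸ Q → Multiplicative (ZMod q)) ⋊[mulAutArrow] G)) (SemidirectProduct.inr g))).comp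
          ψ.continuous }
  have hΛ : ∀ y, Λ y = ⟨d1⁻¹ * Pi.mulSingle ((ψ y : G) : G ⧸ Q) (Multiplicative.ofAdd 1), ψ y⟩ := by
    intro y
    show (SemidirectProduct.inl d1)⁻¹ * SemidirectProduct.inr (ψ y) * (SemidirectProduct.inl d1)⁻¹⁻¹ = _
    rw [inv_inv, ← map_inv, ← SemidirectProduct.mk_eq_inl_mul_inr]
    ext
    · simp only [SemidirectProduct.mul_left, SemidirectProduct.left_inl]
      rw [hd1, mulAutArrow_mulSingle, mul_one]
    · simp only [SemidirectProduct.mul_right, SemidirectProduct.right_inl, mul_one]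
  have hprod := left_eq_pow_mul_left_of_gens EA EB Λ 1 (by rw [hBa, hAa]) (by rw [hBb, hAb])
    (by rw [hΛ, hAa]) (by rw [hΛ, hAb]; rfl) (by rw [hΛ, hBa, hAa, pow_one, hdα])
    (by rw [hΛ, hBb, hAb, pow_one, SemidirectProduct.left_inr, one_mul, ← hβdef, mulSingle_coe_eq_of_mem Q q hβ,
          ← hd1, inv_mul_cancel]) x
  rw [pow_one] at hprod
  have hΛx : (Λ x).left ^ (m * n) = 1 := by
    rw [hprod, mul_pow, hA, hB, one_mul]
  rw [hΛ] at hΛx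
  change (d1⁻¹ * Pi.mulSingle ((ψ x : G) : G ⧸ Q) (Multiplicative.ofAdd 1)) ^ (m * n) = 1 at hΛx
  -- evaluate at the coset `ψx · Q`
  by_contra hxQ
  have hne : ((ψ x : G) : G ⧸ Q) ≠ ((1 : G) : G ⧸ Q) := by
    intro h
    rw [QuotientGroup.eq, mul_one] at h
    exact hxQ ((Q.inv_mem_iff).mp h)
  have hval := congr_fun hΛx ((ψ x : G) : G ⧸ Q)
  rw [Pi.pow_apply, Pi.mul_apply, Pi.inv_apply, hd1, Pi.mulSingle_eq_of_ne hne, inv_one, one_mul,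
    Pi.mulSingle_eq_same, Pi.one_apply, ← ofAdd_nsmul, nsmul_eq_mul, mul_one] at hval
  have hdvd : q ∣ m * n := (ZMod.natCast_eq_zero_iff _ _).mp (Multiplicative.ofAdd.injective hval)
  -- `q = d m ∣ m n` forces `d ∣ n`, i.e. `κ ≡ 0 (mod d)`: contradiction
  have hdn : (d : ℕ) ∣ n := by
    rw [hq, mul_comm (d : ℕ) m] at hdvd
    exact Nat.dvd_of_mul_dvd_mul_left hm0 hdvd
  apply hd
  have hval : ((n : ℕ) : ZMod d) = 0 := (ZMod.natCast_eq_zero_iff n d).mpr hdn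
  have hcast : ((n : ℕ) : ZMod d) = Multiplicative.toAdd (ZHatLevel.level d κ) := by
    have h := ZHatLevel.cast_level_mul d m' κ
    rw [ZMod.castHom_apply, ZMod.cast_eq_val] at h
    exact h
  rw [← ofAdd_toAdd (ZHatLevel.level d κ), ← hcast, hval, ofAdd_zero]

/-- **MAIN THEOREM — no exotic twist stabilisers.**  For EVERY `κ ∈ Ẑ` with `κ ≠ 1` (i.e. `κ ≠ 0` additively; zero
divisors and elements with no positive-integer multiple allowed) and every `x ∈ F̂₂`: `shear κ x = x ⇒ x ∈ Π_v`.
(`Π_v` is closed, so it suffices to test finite quotients `F̂₂ → F̂₂/U`; `map_mem_of_shear_eq`.)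
[cite: MochizukiAbsTopII2013, Prop 1.3 (v) p.12] -/
theorem mem_vertGp_of_shear_eq {κ : ZH} (hκ : κ ≠ 1) {x : F₂hatT} (hx : shear κ x = x) : x ∈ vertGp := by
  classical
  by_contra hxv
  -- a compact set of "differences" missing `1`
  set T : Set F₂hatT := (fun v : F₂hatT => v⁻¹ * x) '' (vertGp : Set F₂hatT) with hT
  have hcl : IsClosed (vertGp : Set F₂hatT) := Subgroup.isClosed_topologicalClosure _
  have hTc : IsCompact T := hcl.isCompact.image (continuous_inv.mul continuous_const)
  have h1T : (1 : F₂hatT) ∈ Tᶜ := by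
    rintro ⟨v, hv, hvx⟩
    apply hxv
    have : x = v := by
      have h := hvx
      rw [inv_mul_eq_one] at h
      exact h.symm
    rw [this]
    exact hv
  obtain ⟨U, hU⟩ := ProfiniteGrp.exist_openNormalSubgroup_sub_open_nhds_of_one hTc.isClosed.isOpen_compl h1T
  -- the finite quotient `F̂₂ / U`
  haveI : Finite (F₂hatT ⧸ U.toSubgroup) := Subgroup.quotient_finite_of_isOpen _ U.toOpenSubgroup.isOpen
  haveI : DiscreteTopology (F₂hatT ⧸ U.toSubgroup) := QuotientGroup.discreteTopology U.toOpenSubgroup.isOpen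
  let ψ : F₂hatT →ₜ* F₂hatT ⧸ U.toSubgroup := ⟨QuotientGroup.mk' U.toSubgroup, QuotientGroup.continuous_mk⟩
  let Qv : Subgroup (F₂hatT ⧸ U.toSubgroup) := vertGp.map (QuotientGroup.mk' U.toSubgroup)
  have hβ : ψ genB ∈ Qv := Subgroup.mem_map_of_mem _ genB_mem_vertGp
  have hαβ : ψ genA * ψ genB * (ψ genA)⁻¹ ∈ Qv := by
    show QuotientGroup.mk' U.toSubgroup genA * QuotientGroup.mk' U.toSubgroup genB *
      (QuotientGroup.mk' U.toSubgroup genA)⁻¹ ∈ Qv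
    rw [← map_mul, ← map_inv, ← map_mul]
    exact Subgroup.mem_map_of_mem _ conj_genB_mem_vertGp
  have hmem := map_mem_of_shear_eq ψ Qv hβ hαβ hκ hx
  obtain ⟨v, hv, hvx⟩ := Subgroup.mem_map.mp hmem
  have hvU : v⁻¹ * x ∈ U := QuotientGroup.eq.mp hvx
  exact hU hvU ⟨v, hv, rfl⟩

/-! ### §6 Consequences at the nodal Dehn-twist datum -/

/-- **`Fix(shear^i κ) = Π_v` for every single `κ ≠ 1`** (`0 < i`; `Ẑ` is torsion-free, so `κ^i ≠ 1`); the converse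
inclusion is abc-iut-L4-t6's `shearPow_mem_vertGp`. Strictly strengthens `forall_shearPow_eq_iff_mem_vertGp`
(abc-iut-f-069 p479118), which needs ALL `κ`. [cite: MochizukiAbsTopII2013, Prop 1.3 (v) p.12] -/
theorem shearPow_eq_self_iff_mem_vertGp {i : ℕ} (hi : 0 < i) {k : ZH} (hk : k ≠ 1) (x : F₂hatT) :
    shearPow i k x = x ↔ x ∈ vertGp := by
  refine ⟨fun h => ?_, fun hx => shearPow_mem_vertGp i k x hx⟩
  have hki : k ^ i ≠ 1 := fun h1 => hk (ZHatCompletion.eq_one_of_pow_eq_one hi.ne' h1)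
  rw [shearPow_apply] at h
  exact mem_vertGp_of_shear_eq hki h

/-- **In `Π_I = F̂₂ ⋊_{shear^i} Ẑ`: an element of `Π_𝔾` commuting with ONE non-trivial element `(1,k)` of the twist
section lies in `Π_v`** (`0 < i`). [cite: MochizukiAbsTopII2013, Prop 1.3 (v) p.12] -/
theorem mem_vertGp_of_commute_inr {i : ℕ} (hi : 0 < i) {k : ZH} (hk : k ≠ 1) {y : F₂hatT}
    (h : Commute (SemidirectProduct.inl y : Ext i) (SemidirectProduct.inr k)) : y ∈ vertGp := by
  have hl := congrArg SemidirectProduct.left h.eq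
  simp only [SemidirectProduct.mul_left, SemidirectProduct.left_inl, SemidirectProduct.right_inl,
    SemidirectProduct.left_inr, map_one, mul_one, SemidirectProduct.right_inr, one_mul] at hl
  exact (shearPow_eq_self_iff_mem_vertGp hi hk y).mp hl.symm

variable {i : ℕ} (hi : 0 < i)

/-- **At `dpsc i hi`: the centraliser of ANY non-trivial element `z ∈ I_v` meets `Π_𝔾` exactly in `Π_v`** — the
element-wise sharpening of Prop 1.3 (v)'s `D_v ∩ Π_𝔾 = Π_v` (`D_v = C_{Π_H}(I_v)`), with no hypothesis on `z` beyond
`z ≠ 1`. [cite: MochizukiAbsTopII2013, Prop 1.3 (v) p.12] -/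
theorem centralizer_inf_PiG_eq_vertSub_of_mem_Iv (v : (dpsc i hi).Vert) {z : (dpsc i hi).PiH}
    (hz : z ∈ (dpsc i hi).Iv v) (hz1 : z ≠ 1) :
    Subgroup.centralizer ({z} : Set (dpsc i hi).PiH) ⊓ (dpsc i hi).PiG = (dpsc i hi).vertSub v := by
  rw [Iv_dpsc_eq_range_inr_holds hi] at hz
  obtain ⟨k, rfl⟩ := hz
  have hk : k ≠ 1 := fun h => hz1 (by rw [h]; exact map_one _)
  rw [dpsc_PiG, dpsc_vertSub]
  ext g
  rw [Subgroup.mem_inf, Subgroup.mem_centralizer_singleton_iff]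
  constructor
  · rintro ⟨hc, ⟨y, rfl⟩⟩
    exact ⟨y, mem_vertGp_of_commute_inr hi hk hc, rfl⟩
  · rintro ⟨y, hy, rfl⟩
    refine ⟨?_, ⟨y, rfl⟩⟩
    have hfix : shearPow i k y = y := shearPow_mem_vertGp i k y hy
    have h := SemidirectProduct.inl_aut (φ := shearPow i) k y
    rw [hfix] at h
    show (SemidirectProduct.inl y * SemidirectProduct.inr k : Ext i) = SemidirectProduct.inr k * SemidirectProduct.inl y
    calc (SemidirectProduct.inl y * SemidirectProduct.inr k : Ext i)
        = SemidirectProduct.inr k * SemidirectProduct.inl y * SemidirectProduct.inr k⁻¹ * SemidirectProduct.inr k := by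
          rw [← h]
      _ = SemidirectProduct.inr k * SemidirectProduct.inl y := by
          rw [mul_assoc, ← map_mul, inv_mul_cancel, map_one, mul_one]

end Literature.AnabelianGeometry.AbsoluteAnabelian.AbsTopII.DehnTwist

end
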